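import Summits.ABC.ABC.Theorems.CuspFieldPencilGoldenCuspShadow
import Summits.ABC.ABC.Theorems.CuspFieldPencilFiveTorsionDictionary
import HarnessLib

/-!
# Sanity (planner, stub-ideation k3 g8 — statements only, NOT a proposal): the min-form class shape

FAMILY 3 (probe the extremes) applied to the LANDED theorem `GoldenCuspShadowBaker.cuspMinRadBound_holds`
(log max(|u|,|w|) ≤ κ_ε · R^ε · min(rad u, rad w)): pushed through the landed dictionary it gives a class
shape strictly stronger than the route target (exponent 1/2), and at the extreme slices u = ±1 / w = ±1
(min = 1) it gives exponent ε — the shape of Cuevas Barrientos–Pasten arXiv:2504.15971 Cor 1.2.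
-/

namespace Summit.ABC.ABC.Theorems.GoldenCuspShadowUpgrade

/-- U1 (optional upgrade target, one prover cycle = copy of `fiveTorsionPayoff_proof` with
`R^{1/2+ε}` replaced by `R^ε · min(rad u, rad w)`, using `min ≥ 1`, `rad ∣ 5N`, `N ≥ 1`). -/
theorem fiveTorsionClassMinShape :
    ∀ ε : ℝ, 0 < ε → ∃ C : ℝ, ∀ u w : ℤ, IsCoprime u w → u * w * (u ^ 2 - 11 * u * w - w ^ 2) ≠ 0 →
      ∀ (W : WeierstrassCurve ℚ) [W.IsElliptic],
        W = ⟨((w : ℚ) - (u : ℚ)), (-((u : ℚ) * (w : ℚ))), (-((u : ℚ) * (w : ℚ) ^ 2)), 0, 0⟩ →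
        Real.log (W.minimalDiscriminantNorm ℤ : ℝ) ≤
          C * (W.conductorNorm ℤ : ℝ) ^ (ε : ℝ) *
            min ((((UniqueFactorizationMonoid.radical u).natAbs : ℕ) : ℝ))
                ((((UniqueFactorizationMonoid.radical w).natAbs : ℕ) : ℝ)) := by
  sorry

/-- U2 (corollary of U1 at the extreme slice `w = 1`, i.e. the integral Tate normal forms E(t,t), t = u ∈ ℤ):
exponent ε — the in-print shape (arXiv:2504.15971 Cor 1.2), here from the tree's ℚ-engine. -/
theorem fiveTorsionIntegralSliceEps :
    ∀ ε : ℝ, 0 < ε → ∃ C : ℝ, ∀ u : ℤ, u * (u ^ 2 - 11 * u - 1) ≠ 0 →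
      ∀ (W : WeierstrassCurve ℚ) [W.IsElliptic],
        W = ⟨(1 - (u : ℚ)), (-(u : ℚ)), (-(u : ℚ)), 0, 0⟩ →
        Real.log (W.minimalDiscriminantNorm ℤ : ℝ) ≤ C * (W.conductorNorm ℤ : ℝ) ^ (ε : ℝ) := by
  sorry

end Summit.ABC.ABC.Theorems.GoldenCuspShadowUpgrade
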